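import Summits.BirchSwinnertonDyer.Rank1Residual.Additive.KatoDescentPerrinRiouRatioUnitOfFacts
import Summits.BirchSwinnertonDyer.Rank1Residual.Additive.KatoDescentDefinedExpStarRigid
import Summits.BirchSwinnertonDyer.Rank1Residual.Additive.PadicLogImage
import HarnessLib

set_option autoImplicit false

/-!
# The display UNIT of the PR-INV lane is PROVED: two Tate-normalised dual-exponential value data of `(W, p)` are
# proportional by a `p`-adic UNIT on the `p`-power levels; hence PR-INV ⟸ {lev, KATO-RIGID}
# (seat `bsd-cm-prr-ty1` g14, cell `bsd-cm`; theorems only: no definition, no named fact, no instance, no `sorry`)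

Part 40 of the seat's kernel cut of stub 3 of the Kato–Perrin-Riou skeletons v4 (cruxes stmt-BirchSwinnertonDyer-19945 /
-19223); OFFER (R) of the seat, GO by planner D561.  Part 38 (E25, `KatoDescentPerrinRiouRatioUnitOfFacts`) proved
PR-INV ⟸ `IsNewformOf.level_eq_conductorNorm` + UNIT + KATO-RIGID with UNIT and KATO-RIGID DISPLAYED; Part 39 (E26,
`KatoDescentDefinedExpStarRigid`) proved (U): data `(d, Λ)`, `(e•d, Λ')` satisfying `Kato2004.DefinedExpStarBody` have
`Λ' k ∅ = ẽ⁻¹ • Λ k ∅` granted one cocycle with `exp*_d ≠ 0`.  THIS FILE proves UNIT itself (`unit_holds`, the display of E25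
VERBATIM as a closed theorem) and draws the corollary `prInv_of_lev_of_katoRigid (hlev) (hKR) : ⟨PR-INV⟩`.
MECHANISM (`unit_holds`, §3), for two «(Z1) ∧ (Z2)» packages `(dᵢ, (DEF)ᵢ, (BALL)ᵢ)` of `Kato2004.PRRatioBody`:
* the two generators of the `ℚ_v`-line `D⁰_dR(V_pW|Γ_{ℚ_v})` differ by a scalar, `d₂ = d₁.smul μ _`
  (`FilZeroLine.exists_ne_zero_and_eq_smul` + the structure's eta; `μ ≠ 0`);
* the LATTICE `log_ω(W(ℚ_p)) = p^m ℤ_p` (§2, `exists_zpow_padicLogLocal`: the Additive cell's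
  `LocalLog.range_padicLog_eq_span_zpow` for `W ⊗ ℚ_p` + `padicLogLocal_eq_padicLog`): some `Q₀` has `log_ω Q₀ = p^m` and
  `‖p^{-m} · log_ω Q‖ ≤ 1` for all `Q`; so (BALL)₁ at `a₀ = e_p(p^{-m})` produces a cocycle `η₀` with `exp*_{d₁}(η₀) = a₀ ≠ 0`
  — the non-degeneracy (U) wants — and E26 gives `Λ₂ k ∅ y = μ̃⁻¹ • Λ₁ k ∅ y` (`μ̃ = e_p⁻¹ μ ∈ ℚ_[p]`);
* `‖μ̃‖ = 1` (§1, `norm_eq_one_of_forall_iff`, a lemma about `ℚ_p` alone): (BALL)₂ and (BALL)₁ describe the images of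
  `exp*_{μ•d₁} = μ⁻¹ exp*_{d₁}` (`expStarCoord_smul_generator`) and of `exp*_{d₁}` by the SAME ball
  `B = {a : ∀ Q, ‖ã · log_ω Q‖ ≤ 1}`, whence `∀ a, a ∈ B ↔ μ̃ a ∈ B`; testing at `a = p^{-m}` and `a = μ̃⁻¹ p^{-m}` against `Q₀`
  gives `‖μ̃‖ ≤ 1` and `‖μ̃⁻¹‖ ≤ 1`.  So `e := μ̃⁻¹` has `‖e‖ = 1`.
HONEST LABEL: UNIT is a theorem about the tree's READING of Kato's `exp*` ((RES)/(DEF) of `Kato2004.DefinedExpStarBody`, (Z2) of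
`Kato2004.PRRatioBody`); the named facts `exists_eulerSystem_definedExpStar_values` / `exists_eulerSystem_expStar_values` are NOT
used.  After this file the display PR-INV of stub 3 reads **PR-INV ⟸ {`IsNewformOf.level_eq_conductorNorm`, KATO-RIGID}**
(`prInv_of_lev_of_katoRigid`), KATO-RIGID (Kato §13.9, p. 230: two admissible families in one pin have unit-proportional
(13.7.1)-values ⇒ proportional bottom Kummer logarithms; displayed in E25) NOT proved — its engine is Kato's Thm. 12.4 (2)
(`Kato2004.thm12_4`, a named fact) + later files.  No stub is closed; nothing is asserted on 19945 / 19223; no summit statement is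
proved; Perrin-Riou's conjecture and Kato's Main Conjecture are untouched; BSD is not proved for any curve.
References: [BlochKato1990] Def. 3.10, Prop. 3.8, Ex. 3.11; [Kato1993LNM1553] Ch. II §1.2.4, Ex. 1.3.5; [Kato2004Asterisque] §9.4
(p. 188), Thm. 12.4 (2) (p. 221), §13.9–Lemma 13.10 (pp. 229–230); [SilvermanAEC2009] IV.6.4, VII.6.3 (the logarithm lattice).
-/

noncomputable section

open scoped Classical NumberField BigOperators TensorProduct

open WeierstrassCurve Field IsDedekindDomain NumberField Rat.HeightOneSpectrum CongruenceSubgroup ValuativeRel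
  Literature.NumberTheory.EllipticCurves Literature.NumberTheory.EllipticCurves.ModularForms
  Literature.NumberTheory.EllipticCurves.Rank1Residual Literature.NumberTheory.EllipticCurves.Rank1Residual.Typed
  Literature.NumberTheory.EllipticCurves.Kato2004 Literature.NumberTheory.EllipticCurves.IwasawaAlgebra
  Literature.NumberTheory.EllipticCurves.Kato2004.EulerSystemValues
  Literature.NumberTheory.GaloisRepresentations Literature.NumberTheory.GaloisRepresentations.PeriodRingData
  Literature.NumberTheory.GaloisRepresentations.IsNonarchimedeanLocalField Literature.NumberTheory.PAdicHodge
  Literature.NumberTheory.AdelicBaseChange Literature.NumberTheory.Automorphic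
open Summit.BirchSwinnertonDyer.BirchSwinnertonDyer.Theorems.CongruentShaFreeCutKatoKummerLogTorsion
open Summit.BirchSwinnertonDyer.Rank1Residual Summit.BirchSwinnertonDyer.Rank1Residual.Additive
open Summit.BirchSwinnertonDyer.Rank1Residual.Additive.LocalLog (range_padicLog_eq_span_zpow)

namespace Summit.BirchSwinnertonDyer.Rank1Residual.Additive.PerrinRiouUnit

/-! ## §1 A ball lemma in `ℚ_p`: `B = u·B` for a non-degenerate bounded ball forces `‖u‖ = 1` -/

section Ball

variable {p : ℕ} [Fact p.Prime]

/-- **`‖u‖ = 1` from `∀ a, (∀ i, ‖a·Lᵢ‖ ≤ 1) ↔ (∀ i, ‖u·a·Lᵢ‖ ≤ 1)`** when the family `L` attains a value `t ≠ 0` with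
`‖t⁻¹·Lᵢ‖ ≤ 1` for all `i` (test `a = t⁻¹` and `a = u⁻¹t⁻¹` at the index of `t`). [folklore] -/
theorem norm_eq_one_of_forall_iff {ι : Type*} (L : ι → ℚ_[p]) {t : ℚ_[p]} (ht : t ≠ 0) (hQ₀ : ∃ i, L i = t)
    (hbd : ∀ i, ‖t⁻¹ * L i‖ ≤ 1) {u : ℚ_[p]} (hu : u ≠ 0)
    (h : ∀ a : ℚ_[p], (∀ i, ‖a * L i‖ ≤ 1) ↔ (∀ i, ‖u * a * L i‖ ≤ 1)) : ‖u‖ = 1 := by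
  obtain ⟨i₀, hi₀⟩ := hQ₀
  have h1 : ‖u‖ ≤ 1 := by
    have h' := (h t⁻¹).mp hbd i₀
    rwa [hi₀, mul_assoc, inv_mul_cancel₀ ht, mul_one] at h'
  have h2 : ‖u⁻¹‖ ≤ 1 := by
    have h' := (h (u⁻¹ * t⁻¹)).mpr (fun i => by rw [mul_inv_cancel_left₀ hu]; exact hbd i) i₀
    rwa [hi₀, mul_assoc, inv_mul_cancel₀ ht, mul_one] at h'
  rw [norm_inv] at h2
  exact le_antisymm h1 ((inv_le_one₀ (norm_pos_iff.mpr hu)).mp h2)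

end Ball

/-! ## §2 The lattice `log_ω(W(ℚ_p)) = p^m ℤ_p` -/

section Lattice

variable (W : WeierstrassCurve ℚ) [W.IsElliptic] [W.IsGloballyMinimal] (p : ℕ) [Fact p.Prime]

/-- **`log_ω(W(ℚ_p)) = p^m · ℤ_p` for some `m ∈ ℤ`**, in the form used below: some local point has `log_ω = p^m`, and
`‖p^{-m} · log_ω Q‖ ≤ 1` for every `Q ∈ W(ℚ_p)` (the Additive cell's `LocalLog.range_padicLog_eq_span_zpow` for `W ⊗ ℚ_p`,
read through `padicLogLocal_eq_padicLog`). [cite: SilvermanAEC2009, IV.6.4 and VII.6.3] -/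
theorem exists_zpow_padicLogLocal :
    ∃ m : ℤ, (∃ Q : (W.baseChange ℚ_[p]).toAffine.Point, padicLogLocal W p Q = (p : ℚ_[p]) ^ m) ∧
      ∀ Q : (W.baseChange ℚ_[p]).toAffine.Point, ‖((p : ℚ_[p]) ^ m)⁻¹ * padicLogLocal W p Q‖ ≤ 1 := by
  obtain ⟨m, hm⟩ : ∃ m : ℤ, (LocalLog.padicLog (W.baseChange ℚ_[p])).range =
      (Submodule.span ℤ_[p] {(p : ℚ_[p]) ^ m}).toAddSubgroup := ⟨_, range_padicLog_eq_span_zpow (W.baseChange ℚ_[p])⟩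
  have ht : ((p : ℚ_[p]) ^ m) ≠ 0 := zpow_ne_zero _ (Nat.cast_ne_zero.mpr (Fact.out : p.Prime).ne_zero)
  refine ⟨m, ?_, fun Q => ?_⟩
  · have hmem : (p : ℚ_[p]) ^ m ∈ (LocalLog.padicLog (W.baseChange ℚ_[p])).range := by
      rw [hm, Submodule.mem_toAddSubgroup]
      exact Submodule.subset_span (Set.mem_singleton _)
    obtain ⟨Q, hQ⟩ := hmem
    exact ⟨Q, by rw [padicLogLocal_eq_padicLog]; exact hQ⟩
  · have hmem : LocalLog.padicLog (W.baseChange ℚ_[p]) Q ∈ (LocalLog.padicLog (W.baseChange ℚ_[p])).range := ⟨Q, rfl⟩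
    rw [hm, Submodule.mem_toAddSubgroup, Submodule.mem_span_singleton] at hmem
    obtain ⟨z, hz⟩ := hmem
    rw [padicLogLocal_eq_padicLog, ← hz, Algebra.smul_def, mul_left_comm, inv_mul_cancel₀ ht, mul_one]
    exact PadicInt.norm_le_one z

end Lattice

/-! ## §3 UNIT proved; PR-INV ⟸ {lev, KATO-RIGID} -/

section Unit

set_option backward.isDefEq.respectTransparency false in
set_option maxHeartbeats 8000000 in
/-- **UNIT — two Tate-normalised dual-exponential value data of `(W, p)` are proportional by a `p`-adic unit on the
`p`-power levels** (the display UNIT of E25 `prInv_of_lev_of_unit_of_katoRigid`, VERBATIM, now a theorem): for two packages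
«(Z1) `Kato2004.DefinedExpStarBody W p fᵢ dᵢ ιᵢ qᵢ Λᵢ` ∧ (Z2) `exp*_{dᵢ}(Z¹) = {a : a · log_ω W(ℚ_p) ⊆ ℤ_p}`» there is `e ∈ ℚ_p`,
`‖e‖ = 1`, with `Λ₂ k ∅ y = e • Λ₁ k ∅ y` for all `k`, `y`.  Proof = module docstring: `d₂ = d₁.smul μ _`; the lattice
`log_ω(W(ℚ_p)) = p^m ℤ_p` yields a cocycle with `exp*_{d₁} ≠ 0` through (Z2)₁, so E26 `definedExpStarBody_smul_apply_eq` gives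
`Λ₂ k ∅ = μ̃⁻¹ • Λ₁ k ∅`; (Z2)₁, (Z2)₂ and `exp*_{μ•d} = μ⁻¹ exp*_d` give `B = μ̃ B` for the ball `B`, so `‖μ̃‖ = 1` (§1).
Nothing about Kato's classes is asserted; the value-existence facts are not used.
[cite: BlochKato1990, Def. 3.10, Prop. 3.8 and Example 3.11] [cite: Kato1993LNM1553, Ch. II §1.2.4 and Ex. 1.3.5]
[cite: SilvermanAEC2009, IV.6.4 and VII.6.3] -/
theorem unit_holds :
    ∀ (W : WeierstrassCurve ℚ) [W.IsElliptic] [W.IsGloballyMinimal] (p : ℕ) [Fact p.Prime],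
      letI : ContinuousSMul ℤ_[p] (W.tateModule p) := TateModule.continuousSMul_padicInt
      letI : Module.Free ℤ_[p] (W.tateModule p) := W.module_free_tateModule_holds p
      letI : Module.Finite ℤ_[p] (W.tateModule p) := W.module_finite_tateModule_holds p
      letI ρT := restrictedTateRep W (NumberField.Place.Completion (Sum.inr ((Rat.HeightOneSpectrum.primesEquiv (R := 𝓞 ℚ)).symm ⟨p, Fact.out⟩) : NumberField.Place ℚ)) p
      letI : ValuativeRel (NumberField.Place.Completion (Sum.inr ((Rat.HeightOneSpectrum.primesEquiv (R := 𝓞 ℚ)).symm ⟨p, Fact.out⟩) : NumberField.Place ℚ)) :=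
        inferInstanceAs (ValuativeRel (((Rat.HeightOneSpectrum.primesEquiv (R := 𝓞 ℚ)).symm ⟨p, Fact.out⟩).adicCompletion ℚ))
      letI : TopologicalSpace (NumberField.Place.Completion (Sum.inr ((Rat.HeightOneSpectrum.primesEquiv (R := 𝓞 ℚ)).symm ⟨p, Fact.out⟩) : NumberField.Place ℚ)) :=
        inferInstanceAs (TopologicalSpace (((Rat.HeightOneSpectrum.primesEquiv (R := 𝓞 ℚ)).symm ⟨p, Fact.out⟩).adicCompletion ℚ))
      haveI : IsNonarchimedeanLocalField (NumberField.Place.Completion (Sum.inr ((Rat.HeightOneSpectrum.primesEquiv (R := 𝓞 ℚ)).symm ⟨p, Fact.out⟩) : NumberField.Place ℚ)) :=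
        inferInstanceAs (IsNonarchimedeanLocalField (((Rat.HeightOneSpectrum.primesEquiv (R := 𝓞 ℚ)).symm ⟨p, Fact.out⟩).adicCompletion ℚ))
      haveI : CharZero (NumberField.Place.Completion (Sum.inr ((Rat.HeightOneSpectrum.primesEquiv (R := 𝓞 ℚ)).symm ⟨p, Fact.out⟩) : NumberField.Place ℚ)) := LocalField.charZero_adicCompletion ((Rat.HeightOneSpectrum.primesEquiv (R := 𝓞 ℚ)).symm ⟨p, Fact.out⟩)
      letI : Algebra ℚ_[p] (NumberField.Place.Completion (Sum.inr ((Rat.HeightOneSpectrum.primesEquiv (R := 𝓞 ℚ)).symm ⟨p, Fact.out⟩) : NumberField.Place ℚ)) :=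
        LocalField.adicCompletionPadicAlgebra ((Rat.HeightOneSpectrum.primesEquiv (R := 𝓞 ℚ)).symm ⟨p, Fact.out⟩) p ((natCast_mem_asIdeal_iff_eq_primesEquiv_symm _ (Fact.out : p.Prime)).mpr rfl)
      haveI : Fact (¬ IsUnit ((p : ℕ) : integerC (NumberField.Place.Completion (Sum.inr ((Rat.HeightOneSpectrum.primesEquiv (R := 𝓞 ℚ)).symm ⟨p, Fact.out⟩) : NumberField.Place ℚ)))) :=
        ⟨not_isUnit_natCast_integerC (show valuation (NumberField.Place.Completion (Sum.inr ((Rat.HeightOneSpectrum.primesEquiv (R := 𝓞 ℚ)).symm ⟨p, Fact.out⟩) : NumberField.Place ℚ)) ((p : ℕ) : (NumberField.Place.Completion (Sum.inr ((Rat.HeightOneSpectrum.primesEquiv (R := 𝓞 ℚ)).symm ⟨p, Fact.out⟩) : NumberField.Place ℚ))) < 1 from LocalField.valuation_adicCompletion_natCast_lt_one ((Rat.HeightOneSpectrum.primesEquiv (R := 𝓞 ℚ)).symm ⟨p, Fact.out⟩) p ((natCast_mem_asIdeal_iff_eq_primesEquiv_symm _ (Fact.out : p.Prime)).mpr rfl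))⟩
      haveI := isAdicComplete_integerC_natCast (show valuation (NumberField.Place.Completion (Sum.inr ((Rat.HeightOneSpectrum.primesEquiv (R := 𝓞 ℚ)).symm ⟨p, Fact.out⟩) : NumberField.Place ℚ)) ((p : ℕ) : (NumberField.Place.Completion (Sum.inr ((Rat.HeightOneSpectrum.primesEquiv (R := 𝓞 ℚ)).symm ⟨p, Fact.out⟩) : NumberField.Place ℚ))) < 1 from LocalField.valuation_adicCompletion_natCast_lt_one ((Rat.HeightOneSpectrum.primesEquiv (R := 𝓞 ℚ)).symm ⟨p, Fact.out⟩) p ((natCast_mem_asIdeal_iff_eq_primesEquiv_symm _ (Fact.out : p.Prime)).mpr rfl))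
      -- the tree's `ℚ`-algebra structure on `ℚ_v` (the one W2's restricted representations are built on) is pinned
      -- as the most recent local instance, so that it — and not `DivisionRing.toRatAlgebra` — is synthesized below
      letI : Algebra ℚ (NumberField.Place.Completion (Sum.inr ((Rat.HeightOneSpectrum.primesEquiv (R := 𝓞 ℚ)).symm ⟨p, Fact.out⟩) : NumberField.Place ℚ)) := NumberField.Place.instAlgebraCompletion (Sum.inr ((Rat.HeightOneSpectrum.primesEquiv (R := 𝓞 ℚ)).symm ⟨p, Fact.out⟩) : NumberField.Place ℚ)
      ∀ {N₁ : ℕ} [NeZero N₁] (f₁ : CuspForm (Gamma0 N₁) 2) {N₂ : ℕ} [NeZero N₂] (f₂ : CuspForm (Gamma0 N₂) 2)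
        (ι₁ ι₂ : (n : ℕ) → (CyclotomicField n ℚ →+* ℂ)) (q₁ q₂ : ℚ)
        (Λ₁ Λ₂ : ∀ (k : ℕ) (r : Finset (HeightOneSpectrum (𝓞 ℚ))),
          H1 (tateRep W p) (cycSubgroup p k r) →ₗ[ℤ_[p]] ℚ_[p] ⊗[ℚ] CyclotomicField (cycLevel p k r) ℚ),
      (∃ d, DefinedExpStarBody W p f₁ d ι₁ ((q₁ : ℚ) : ℝ) Λ₁ ∧
        ∀ a : (NumberField.Place.Completion (Sum.inr ((Rat.HeightOneSpectrum.primesEquiv (R := 𝓞 ℚ)).symm ⟨p, Fact.out⟩) : NumberField.Place ℚ)),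
          (∃ η : contOneCocycles ρT.toTopRep, expStarCoord W (show valuation (NumberField.Place.Completion (Sum.inr ((Rat.HeightOneSpectrum.primesEquiv (R := 𝓞 ℚ)).symm ⟨p, Fact.out⟩) : NumberField.Place ℚ)) ((p : ℕ) : (NumberField.Place.Completion (Sum.inr ((Rat.HeightOneSpectrum.primesEquiv (R := 𝓞 ℚ)).symm ⟨p, Fact.out⟩) : NumberField.Place ℚ))) < 1 from LocalField.valuation_adicCompletion_natCast_lt_one ((Rat.HeightOneSpectrum.primesEquiv (R := 𝓞 ℚ)).symm ⟨p, Fact.out⟩) p ((natCast_mem_asIdeal_iff_eq_primesEquiv_symm _ (Fact.out : p.Prime)).mpr rfl)) d η = a) ↔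
            ∀ Q : (W.baseChange ℚ_[p]).toAffine.Point,
              ‖(Padic.adicCompletionEquiv (𝓞 ℚ) ⟨p, Fact.out⟩).symm
                  (show ((Rat.HeightOneSpectrum.primesEquiv (R := 𝓞 ℚ)).symm ⟨p, Fact.out⟩).adicCompletion ℚ from a) * padicLogLocal W p Q‖ ≤ 1) →
      (∃ d, DefinedExpStarBody W p f₂ d ι₂ ((q₂ : ℚ) : ℝ) Λ₂ ∧
        ∀ a : (NumberField.Place.Completion (Sum.inr ((Rat.HeightOneSpectrum.primesEquiv (R := 𝓞 ℚ)).symm ⟨p, Fact.out⟩) : NumberField.Place ℚ)),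
          (∃ η : contOneCocycles ρT.toTopRep, expStarCoord W (show valuation (NumberField.Place.Completion (Sum.inr ((Rat.HeightOneSpectrum.primesEquiv (R := 𝓞 ℚ)).symm ⟨p, Fact.out⟩) : NumberField.Place ℚ)) ((p : ℕ) : (NumberField.Place.Completion (Sum.inr ((Rat.HeightOneSpectrum.primesEquiv (R := 𝓞 ℚ)).symm ⟨p, Fact.out⟩) : NumberField.Place ℚ))) < 1 from LocalField.valuation_adicCompletion_natCast_lt_one ((Rat.HeightOneSpectrum.primesEquiv (R := 𝓞 ℚ)).symm ⟨p, Fact.out⟩) p ((natCast_mem_asIdeal_iff_eq_primesEquiv_symm _ (Fact.out : p.Prime)).mpr rfl)) d η = a) ↔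
            ∀ Q : (W.baseChange ℚ_[p]).toAffine.Point,
              ‖(Padic.adicCompletionEquiv (𝓞 ℚ) ⟨p, Fact.out⟩).symm
                  (show ((Rat.HeightOneSpectrum.primesEquiv (R := 𝓞 ℚ)).symm ⟨p, Fact.out⟩).adicCompletion ℚ from a) * padicLogLocal W p Q‖ ≤ 1) →
      ∃ e : ℚ_[p], ‖e‖ = 1 ∧ ∀ (k : ℕ) (y : H1 (tateRep W p) (cycSubgroup p k ∅)), Λ₂ k ∅ y = e • Λ₁ k ∅ y := by
  intro W _ _ p _
  letI instC : ContinuousSMul ℤ_[p] (W.tateModule p) := TateModule.continuousSMul_padicInt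
  letI instF : Module.Free ℤ_[p] (W.tateModule p) := W.module_free_tateModule_holds p
  letI instFi : Module.Finite ℤ_[p] (W.tateModule p) := W.module_finite_tateModule_holds p
  -- the local-field structure terms of the statement's `letI` chain, re-installed as local instances
  letI : ValuativeRel (NumberField.Place.Completion (Sum.inr ((Rat.HeightOneSpectrum.primesEquiv (R := 𝓞 ℚ)).symm ⟨p, Fact.out⟩) : NumberField.Place ℚ)) :=
    inferInstanceAs (ValuativeRel (((Rat.HeightOneSpectrum.primesEquiv (R := 𝓞 ℚ)).symm ⟨p, Fact.out⟩).adicCompletion ℚ))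
  letI : TopologicalSpace (NumberField.Place.Completion (Sum.inr ((Rat.HeightOneSpectrum.primesEquiv (R := 𝓞 ℚ)).symm ⟨p, Fact.out⟩) : NumberField.Place ℚ)) :=
    inferInstanceAs (TopologicalSpace (((Rat.HeightOneSpectrum.primesEquiv (R := 𝓞 ℚ)).symm ⟨p, Fact.out⟩).adicCompletion ℚ))
  haveI : IsNonarchimedeanLocalField (NumberField.Place.Completion (Sum.inr ((Rat.HeightOneSpectrum.primesEquiv (R := 𝓞 ℚ)).symm ⟨p, Fact.out⟩) : NumberField.Place ℚ)) :=
    inferInstanceAs (IsNonarchimedeanLocalField (((Rat.HeightOneSpectrum.primesEquiv (R := 𝓞 ℚ)).symm ⟨p, Fact.out⟩).adicCompletion ℚ))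
  haveI : CharZero (NumberField.Place.Completion (Sum.inr ((Rat.HeightOneSpectrum.primesEquiv (R := 𝓞 ℚ)).symm ⟨p, Fact.out⟩) : NumberField.Place ℚ)) := LocalField.charZero_adicCompletion ((Rat.HeightOneSpectrum.primesEquiv (R := 𝓞 ℚ)).symm ⟨p, Fact.out⟩)
  letI : Algebra ℚ_[p] (NumberField.Place.Completion (Sum.inr ((Rat.HeightOneSpectrum.primesEquiv (R := 𝓞 ℚ)).symm ⟨p, Fact.out⟩) : NumberField.Place ℚ)) :=
    LocalField.adicCompletionPadicAlgebra ((Rat.HeightOneSpectrum.primesEquiv (R := 𝓞 ℚ)).symm ⟨p, Fact.out⟩) p ((natCast_mem_asIdeal_iff_eq_primesEquiv_symm _ (Fact.out : p.Prime)).mpr rfl)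
  haveI : Fact (¬ IsUnit ((p : ℕ) : integerC (NumberField.Place.Completion (Sum.inr ((Rat.HeightOneSpectrum.primesEquiv (R := 𝓞 ℚ)).symm ⟨p, Fact.out⟩) : NumberField.Place ℚ)))) :=
    ⟨not_isUnit_natCast_integerC (show valuation (NumberField.Place.Completion (Sum.inr ((Rat.HeightOneSpectrum.primesEquiv (R := 𝓞 ℚ)).symm ⟨p, Fact.out⟩) : NumberField.Place ℚ)) ((p : ℕ) : (NumberField.Place.Completion (Sum.inr ((Rat.HeightOneSpectrum.primesEquiv (R := 𝓞 ℚ)).symm ⟨p, Fact.out⟩) : NumberField.Place ℚ))) < 1 from LocalField.valuation_adicCompletion_natCast_lt_one ((Rat.HeightOneSpectrum.primesEquiv (R := 𝓞 ℚ)).symm ⟨p, Fact.out⟩) p ((natCast_mem_asIdeal_iff_eq_primesEquiv_symm _ (Fact.out : p.Prime)).mpr rfl))⟩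
  haveI := isAdicComplete_integerC_natCast (show valuation (NumberField.Place.Completion (Sum.inr ((Rat.HeightOneSpectrum.primesEquiv (R := 𝓞 ℚ)).symm ⟨p, Fact.out⟩) : NumberField.Place ℚ)) ((p : ℕ) : (NumberField.Place.Completion (Sum.inr ((Rat.HeightOneSpectrum.primesEquiv (R := 𝓞 ℚ)).symm ⟨p, Fact.out⟩) : NumberField.Place ℚ))) < 1 from LocalField.valuation_adicCompletion_natCast_lt_one ((Rat.HeightOneSpectrum.primesEquiv (R := 𝓞 ℚ)).symm ⟨p, Fact.out⟩) p ((natCast_mem_asIdeal_iff_eq_primesEquiv_symm _ (Fact.out : p.Prime)).mpr rfl))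
  -- the tree's `ℚ`-algebra structure on `ℚ_v` (the one W2's restricted representations are built on) is pinned
  -- as the most recent local instance, so that it — and not `DivisionRing.toRatAlgebra` — is synthesized below
  letI : Algebra ℚ (NumberField.Place.Completion (Sum.inr ((Rat.HeightOneSpectrum.primesEquiv (R := 𝓞 ℚ)).symm ⟨p, Fact.out⟩) : NumberField.Place ℚ)) := NumberField.Place.instAlgebraCompletion (Sum.inr ((Rat.HeightOneSpectrum.primesEquiv (R := 𝓞 ℚ)).symm ⟨p, Fact.out⟩) : NumberField.Place ℚ)
  intro N₁ _ f₁ N₂ _ f₂ ι₁ ι₂ q₁ q₂ Λ₁ Λ₂ h₁ h₂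
  obtain ⟨d₁, hD₁, hB₁⟩ := h₁
  obtain ⟨d₂, hD₂, hB₂⟩ := h₂
  -- the two generators differ by a scalar `μ ≠ 0`: `d₂ = d₁.smul μ _`
  obtain ⟨μ, hμ0, hμ⟩ := d₁.exists_ne_zero_and_eq_smul d₂
  have hd₂ : d₂ = d₁.smul μ hμ0 := by
    cases d₂ with
    | mk ω hD hF hne hsm =>
      simp only at hμ
      subst hμ
      rfl
  subst hd₂
  -- the lattice `log_ω(W(ℚ_p)) = p^m ℤ_p`
  obtain ⟨m, ⟨Q₀, hQ₀⟩, hbd⟩ := exists_zpow_padicLogLocal W p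
  have ht0 : ((p : ℚ_[p]) ^ m) ≠ 0 := zpow_ne_zero _ (Nat.cast_ne_zero.mpr (Fact.out : p.Prime).ne_zero)
  -- a cocycle with `exp*_{d₁} ≠ 0`, from (Z2)₁ at `a₀ = e_p (p^m)⁻¹`
  obtain ⟨η₀, hη₀⟩ := (hB₁ ((Padic.adicCompletionEquiv (𝓞 ℚ) ⟨p, Fact.out⟩) ((p : ℚ_[p]) ^ m)⁻¹)).mpr (fun Q => by
    simpa only [ContinuousAlgEquiv.symm_apply_apply] using hbd Q)
  have hne := hη₀.trans_ne ((_root_.map_ne_zero (Padic.adicCompletionEquiv (𝓞 ℚ) ⟨p, Fact.out⟩)).mpr (inv_ne_zero ht0))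
  -- (U) of E26: `Λ₂ k ∅ y = μ̃⁻¹ • Λ₁ k ∅ y`
  have hU := definedExpStarBody_smul_apply_eq W p f₁ f₂ ι₁ ι₂ ((q₁ : ℚ) : ℝ) ((q₂ : ℚ) : ℝ) Λ₁ Λ₂ μ hμ0 hD₁ hD₂ ⟨η₀, hne⟩
  refine ⟨_, ?_, hU⟩
  -- `‖μ̃‖ = 1` by the ball lemma
  have hμt : ‖(Padic.adicCompletionEquiv (𝓞 ℚ) ⟨p, Fact.out⟩).symm (μ : (((Rat.HeightOneSpectrum.primesEquiv (R := 𝓞 ℚ)).symm ⟨p, Fact.out⟩).adicCompletion ℚ))‖ = 1 := by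
    refine norm_eq_one_of_forall_iff (fun Q => padicLogLocal W p Q) ht0 ⟨Q₀, hQ₀⟩ hbd
      ((_root_.map_ne_zero _).mpr hμ0) fun a => ?_
    have h2 := hB₂ ((Padic.adicCompletionEquiv (𝓞 ℚ) ⟨p, Fact.out⟩) a)
    have h1 := hB₁ (μ * (show NumberField.Place.Completion (Sum.inr ((Rat.HeightOneSpectrum.primesEquiv (R := 𝓞 ℚ)).symm ⟨p, Fact.out⟩) : NumberField.Place ℚ) from (Padic.adicCompletionEquiv (𝓞 ℚ) ⟨p, Fact.out⟩) a))
    simp only [_root_.map_mul, ContinuousAlgEquiv.symm_apply_apply] at h1 h2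
    rw [← h2, ← h1]
    simp only [expStarCoord_smul_generator, inv_mul_eq_iff_eq_mul₀ hμ0]
  simpa only [norm_inv, inv_eq_one] using hμt

/-- **PR-INV ⟸ {lev, KATO-RIGID}**: the display PR-INV of stub 3 (A2's `hPRinv`, verbatim) from the level identification
`IsNewformOf.level_eq_conductorNorm` and the display KATO-RIGID of E25 alone — E25 `prInv_of_lev_of_unit_of_katoRigid` with its
UNIT binder discharged by `unit_holds`.  KATO-RIGID (Kato §13.9: two admissible families in one pin with unit-proportional
(13.7.1)-values have proportional bottom Kummer logarithms) is DISPLAYED, not proved; no stub is closed; nothing is asserted on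
19945 / 19223; BSD is not proved for any curve.
[cite: Kato2004Asterisque, Thm. 12.4 (2) (p. 221) and §13.9–Lemma 13.10 (pp. 229–230)] [cite: BlochKato1990, Prop. 3.8 and Ex. 3.11] -/
theorem prInv_of_lev_of_katoRigid
    (hlev : ∀ (N : ℕ) [NeZero N], IsNewformOf.level_eq_conductorNorm (N := N))
    (hKR : ∀ (W : WeierstrassCurve ℚ) [W.IsElliptic] [W.IsGloballyMinimal] (p : ℕ) [Fact p.Prime],
      letI : ContinuousSMul ℤ_[p] (W.tateModule p) := TateModule.continuousSMul_padicInt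
      letI : Module.Free ℤ_[p] (W.tateModule p) := W.module_free_tateModule_holds p
      letI : Module.Finite ℤ_[p] (W.tateModule p) := W.module_finite_tateModule_holds p
      ∀ (hp : p ≠ 2) {N : ℕ} [NeZero N] (f : CuspForm (Gamma0 N) 2), IsNewformOf W f →
      ∀ (ι₁ ι₂ : (n : ℕ) → (CyclotomicField n ℚ →+* ℂ)) (q₁ q₂ : ℚ)
        (Λ₁ Λ₂ : ∀ (k : ℕ) (r : Finset (HeightOneSpectrum (𝓞 ℚ))),
          H1 (tateRep W p) (cycSubgroup p k r) →ₗ[ℤ_[p]] ℚ_[p] ⊗[ℚ] CyclotomicField (cycLevel p k r) ℚ) (e : ℚ_[p]),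
        q₁ ≠ 0 → q₂ ≠ 0 → e ≠ 0 → (∀ (k : ℕ) (y : H1 (tateRep W p) (cycSubgroup p k ∅)), Λ₂ k ∅ y = e • Λ₁ k ∅ y) →
      ∀ (c₁ d₁ a₁ : ℤ) (A₁ : ℕ) (d'₁ : ℤ) (c₂ d₂ a₂ : ℤ) (A₂ : ℕ) (d'₂ : ℤ),
        0 < A₁ → Int.gcd c₁ (6 * p * A₁) = 1 → Int.gcd d₁ (6 * p * N) = 1 → (d₁ : ℤ) * d'₁ ≡ 1 [ZMOD (A₁ : ℤ)] →
        ratCuspFactor f true c₁ d₁ a₁ A₁ d'₁ ≠ 0 →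
        0 < A₂ → Int.gcd c₂ (6 * p * A₂) = 1 → Int.gcd d₂ (6 * p * N) = 1 → (d₂ : ℤ) * d'₂ ≡ 1 [ZMOD (A₂ : ℤ)] →
        ratCuspFactor f true c₂ d₂ a₂ A₂ d'₂ ≠ 0 →
      ∀ (z₁ : ∀ (k : ℕ) (r : (cyclotomicLevelsRat p (badPlaces c₁ d₁ A₁ N)).Ideals),
          H1 (tateRep W p) ((cyclotomicLevelsRat p (badPlaces c₁ d₁ A₁ N)).level k r.1))
        (x₁ : ∀ (k : ℕ) (r : (cyclotomicLevelsRat p (badPlaces c₁ d₁ A₁ N)).Ideals), CyclotomicField (cycLevel p k r.1) ℚ),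
        ZetaBody W p f ι₁ ((q₁ : ℚ) : ℝ) Λ₁ c₁ d₁ a₁ A₁ z₁ x₁ →
      ∀ (z₂ : ∀ (k : ℕ) (r : (cyclotomicLevelsRat p (badPlaces c₂ d₂ A₂ N)).Ideals),
          H1 (tateRep W p) ((cyclotomicLevelsRat p (badPlaces c₂ d₂ A₂ N)).level k r.1))
        (x₂ : ∀ (k : ℕ) (r : (cyclotomicLevelsRat p (badPlaces c₂ d₂ A₂ N)).Ideals), CyclotomicField (cycLevel p k r.1) ℚ),
        ZetaBody W p f ι₂ ((q₂ : ℚ) : ℝ) Λ₂ c₂ d₂ a₂ A₂ z₂ x₂ →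
      ∀ (K : ZpExtension ℚ p) (hK : K.IsCyclotomic) (γ : absoluteGaloisGroup ℚ), K.IsTopGenerator γ →
      ∀ (I : IwasawaH1Data W p K γ) (y₁ y₂ : I.H),
        (∀ n : ℕ, I.proj n y₁ = levelToLayer W p hK hp (badPlaces c₁ d₁ A₁ N) n
          (z₁ (n + 1) (cyclotomicLevelsRat p (badPlaces c₁ d₁ A₁ N)).idealOne)) →
        (∀ n : ℕ, I.proj n y₂ = levelToLayer W p hK hp (badPlaces c₂ d₂ A₂ N) n
          (z₂ (n + 1) (cyclotomicLevelsRat p (badPlaces c₂ d₂ A₂ N)).idealOne)) →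
      ∀ (t₁ t₂ : ℚ_[p]), HasLocPKummerLog W p (layerZeroToTop W p K (I.proj 0 y₁)) t₁ →
        HasLocPKummerLog W p (layerZeroToTop W p K (I.proj 0 y₂)) t₂ →
        e * ((q₁ * ratCuspFactor f true c₁ d₁ a₁ A₁ d'₁ * ∏ ℓ ∈ (p * A₁).primeFactors, eulerFactorAtOne W N ℓ : ℚ) : ℚ_[p]) * t₂ =
          ((q₂ * ratCuspFactor f true c₂ d₂ a₂ A₂ d'₂ * ∏ ℓ ∈ (p * A₂).primeFactors, eulerFactorAtOne W N ℓ : ℚ) : ℚ_[p]) * t₁) :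
    ∀ (W : WeierstrassCurve ℚ) [W.IsElliptic] [W.IsGloballyMinimal] (p : ℕ) [Fact p.Prime]
      (ℒ₁ ℒ₂ : ℚ_[p]), Kato2004.PRRatio W p ℒ₁ → Kato2004.PRRatio W p ℒ₂ → ∃ w : ℚ_[p], ‖w‖ = 1 ∧ ℒ₂ = w * ℒ₁ :=
  prInv_of_lev_of_unit_of_katoRigid hlev unit_holds hKR

end Unit

end Summit.BirchSwinnertonDyer.Rank1Residual.Additive.PerrinRiouUnit

end
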